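import Summits.HodgeConjecture.HodgeConjecture.Theorems.AmpleAdicLefschetzThickNecessary
import Summits.HodgeConjecture.HodgeConjecture.Theorems.AmpleAdicLefschetzAlgebraicClassesHodgeTypeProof

/-!
# Route AmpleAdicLefschetz — `ThickNecessary` (item stmt-HodgeConjecture-2617) from the route's own
# items: Grothendieck's (∗) is no longer needed

`Theorems/AmpleAdicLefschetzThickNecessary` proves
`ampleAdicLefschetz_thickNecessary_of_weakLefschetzInjective : (∗) → WeakLefschetzInjective →
ThickNecessary`, where (∗) is the Barriers named fact
`Literature.Barriers.HodgeConjecture.Grothendieck1969_supportedClasses_le_hodgeFiltration`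
(`Nᵖ Hⁱ ⊆ Fᵖ Hⁱ` for ALL `i`), used there at exactly one place and only in degree `i = 2p`
(`mem_hodgeClasses_of_ofRatClass_mem_algebraicClasses`).  That slice is now a THEOREM
(`algebraicClasses_pullback_mem_hodgePQ`, item `AlgebraicClassesHodgeType`,
`Theorems/AmpleAdicLefschetzAlgebraicClassesHodgeTypeProof`), so this file re-runs the two theorems
of that file through which (∗) was threaded with the slice supplied, and concludes
`ampleAdicLefschetz_thickNecessary_of_weakLefschetzInjective'  : WeakLefschetzInjective →
ThickNecessary` — item 2617 now depends on the route's support item `WeakLefschetzInjective` alone.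
Everything here is proved; no named facts.
-/

set_option linter.dupNamespace false

open scoped TensorProduct
open CategoryTheory
open Literature.AlgebraicGeometry Literature.AlgebraicGeometry.HodgeTheory
open Literature.AlgebraicGeometry.Motives Literature.AlgebraicTopology.SingularHomology

namespace Summit.HodgeConjecture.HodgeConjecture.Theorems

/-- **Rational algebraic classes are Hodge classes, unconditionally**: for `Y` smooth projective
with a Hodge symmetric model `B` and `v ∈ H²ᵖ(Y(ℂ); ℚ)` with `v ⊗ 1` algebraic, `v` is a Hodge
class of `B.hodgeStructure` (`Hdgᵖ = V ∩ Fᵖ`; the slice `Nᵖ H²ᵖ ⊆ H^{p,p} ⊆ Fᵖ H²ᵖ` is the theorem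
`algebraicClasses_pullback_mem_hodgePQ`). [cite: VoisinHodgeI2002, §7.1.1 and Prop. 11.20] -/
theorem mem_hodgeClasses_of_ofRatClass_mem_algebraicClasses' {m p : ℕ} {Y : SchemeOver ℂ}
    (hY : IsSmoothProjective m Y) (B : HodgeModel m Y) (hB : B.IsHodgeSymmetric)
    {v : singularCohomology ℚ ℚ (ComplexPoints Y) (2 * p)}
    (hv : ofRatClass (ComplexPoints Y) (2 * p) v ∈ algebraicClasses Y p) :
    v ∈ (B.hodgeStructure hY hB (2 * p)).hodgeClasses p := by
  rw [HodgeStructure.mem_hodgeClasses_iff, HodgeModel.hodgeStructure_F, HodgeModel.mem_ratF_iff,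
    HodgeModel.complexification_ofRat, Int.toNat_natCast]
  have h := algebraicClasses_pullback_mem_hodgePQ hY B p hv
  exact B.hodgePQ_le_hodgeFiltration (k := 2 * p) (p := p) (q := p) (r := p) (by omega) le_rfl h

/-- **THICK for one morphism from HC for `X` and a lift of Hodge classes, unconditionally in (∗)**
(`exists_mem_algebraicClasses_map_eq_of_lift` of `Theorems/AmpleAdicLefschetzThickNecessary` with
Grothendieck's (∗) replaced by the theorem `mem_hodgeClasses_of_ofRatClass_mem_algebraicClasses'`;
same printed proof: universal coefficients on `X` and `Y`, `Alg(Y)` spanned by rational classes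
which are Hodge classes, flatness of `ℂ/ℚ`, the lift, HC on `X`).
[cite: Voisin2025, proof of Prop. 3.8] [cite: VoisinHodgeI2002, §7.1.1 and Prop. 11.20] -/
theorem exists_mem_algebraicClasses_map_eq_of_lift'
    {n m p : ℕ} {X Y : SchemeOver ℂ} (f : Y ⟶ X) (hX : IsSmoothProjective n X)
    (hY : IsSmoothProjective m Y) (A : HodgeModel n X) (hA : A.IsHodgeSymmetric)
    (B : HodgeModel m Y) (hB : B.IsHodgeSymmetric)
    (hHC : ∀ c : complexBetti X (2 * p), IsRationalClass c → IsOfHodgeType n X (2 * p) p p c →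
      c ∈ algebraicClasses X p)
    (hlift : ∀ v : singularCohomology ℚ ℚ (ComplexPoints X) (2 * p),
      (singularCohomology.map ℚ ℚ (AlgPoints.mapContinuous (L := ℂ) f) (2 * p)).hom v ∈
          (B.hodgeStructure hY hB (2 * p)).hodgeClasses p →
        ∃ v' ∈ (A.hodgeStructure hX hA (2 * p)).hodgeClasses p,
          (singularCohomology.map ℚ ℚ (AlgPoints.mapContinuous (L := ℂ) f) (2 * p)).hom v' =
            (singularCohomology.map ℚ ℚ (AlgPoints.mapContinuous (L := ℂ) f) (2 * p)).hom v)
    {c : complexBetti Y (2 * p)} (hc : c ∈ algebraicClasses Y p)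
    (hcf : c ∈ LinearMap.range (complexBetti.map f (2 * p)).hom) :
    ∃ a ∈ algebraicClasses X p, complexBetti.map f (2 * p) a = c := by
  set DX := (A.hodgeStructure hX hA (2 * p)).hodgeClasses p with hDX
  set DY := (B.hodgeStructure hY hB (2 * p)).hodgeClasses p with hDY
  set fQ := (singularCohomology.map ℚ ℚ (AlgPoints.mapContinuous (L := ℂ) f) (2 * p)).hom
    with hfQ
  set βX := ofRatClassBaseChange (ComplexPoints X) (2 * p) with hβX
  set βY := ofRatClassBaseChange (ComplexPoints Y) (2 * p) with hβY
  -- `c = f^* (β_X u)`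
  obtain ⟨b, hb⟩ := hcf
  obtain ⟨u, rfl⟩ := ofRatClassBaseChange_surjective hX (2 * p) b
  have hnat : ∀ x, βY (fQ.baseChange ℂ x) = complexBetti.map f (2 * p) (βX x) :=
    fun x ↦ HodgeModel.ofRatClassBaseChange_baseChange_map f (2 * p) x
  -- `Alg(Y) ⊆ β_Y (Hdg(Y)_ℂ)`
  have hAlgY : algebraicClasses Y p ≤ (DY.baseChange ℂ).map βY := by
    refine (supportedClasses_le_span_isRationalClass hY (2 * p) p).trans (Submodule.span_le.2 ?_)
    rintro c' ⟨hr, ha⟩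
    obtain ⟨v, rfl⟩ := (isRationalClass_iff_mem_range_ofRatClass c').1 hr
    refine ⟨HodgeStructure.ofRat v, ?_, ?_⟩
    · rw [HodgeStructure.ofRat_apply]
      exact Submodule.tmul_mem_baseChange_of_mem 1
        (mem_hodgeClasses_of_ofRatClass_mem_algebraicClasses' hY B hB ha)
    · rw [HodgeStructure.ofRat_apply, hβY, ofRatClassBaseChange_tmul, one_smul]
  -- `f^*_ℂ u ∈ Hdg(Y)_ℂ`
  have h1 : fQ.baseChange ℂ u ∈ DY.baseChange ℂ := by
    have hc' : βY (fQ.baseChange ℂ u) ∈ (DY.baseChange ℂ).map βY := by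
      rw [hnat]
      exact hAlgY (hb ▸ hc)
    obtain ⟨t, ht, hteq⟩ := hc'
    rwa [← ofRatClassBaseChange_injective _ (2 * p) hteq]
  -- `u ∈ ((f^*)⁻¹ Hdg(Y))_ℂ`
  have h2 : u ∈ (DY.comap fQ).baseChange ℂ := by
    have e : DY.comap fQ = LinearMap.ker (DY.mkQ ∘ₗ fQ) := by
      rw [LinearMap.ker_comp, Submodule.ker_mkQ]
    rw [e, HodgeStructure.mem_baseChange_ker_iff, LinearMap.baseChange_comp, LinearMap.comp_apply,
      ← HodgeStructure.mem_baseChange_ker_iff, Submodule.ker_mkQ]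
    exact h1
  -- the lift: `f^* ((f^*)⁻¹ Hdg(Y)) ⊆ f^* Hdg(X)`
  have h3 : (DY.comap fQ).map fQ ≤ DX.map fQ := by
    rintro _ ⟨v, hv, rfl⟩
    obtain ⟨v', hv', he⟩ := hlift v (Submodule.mem_comap.1 hv)
    exact ⟨v', hv', he⟩
  -- `f^*_ℂ u = f^*_ℂ w` with `w ∈ Hdg(X)_ℂ`
  have h4 : fQ.baseChange ℂ u ∈ (DX.map fQ).baseChange ℂ := by
    refine Submodule.baseChange_mono ℂ h3 ?_
    rw [HodgeStructure.baseChange_map]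
    exact Submodule.mem_map_of_mem h2
  rw [HodgeStructure.baseChange_map] at h4
  obtain ⟨w, hw, hweq⟩ := h4
  refine ⟨βX w, map_baseChange_hodgeClasses_le_algebraicClasses hX A hA hHC ⟨w, hw, rfl⟩, ?_⟩
  rw [← hnat, hweq, hnat]
  exact hb

/-- **THICK for one morphism with `f^*` injective on `H²ᵖ(X(ℂ); ℂ)`, from the Hodge conjecture
for `X` alone** (`exists_mem_algebraicClasses_map_eq_of_injective` of
`Theorems/AmpleAdicLefschetzThickNecessary` without Grothendieck's (∗)): for `v ∈ H²ᵖ(X(ℂ); ℚ)`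
with `f^* v` a Hodge class, `v` itself is a Hodge class (`hom_mem_hodgeClasses_of_injective`), so
`exists_mem_algebraicClasses_map_eq_of_lift'` applies with the identity lift.
[cite: VoisinHodgeI2002, §7.3.1, §7.3.2 and Prop. 11.20] -/
theorem exists_mem_algebraicClasses_map_eq_of_injective'
    {n m p : ℕ} {X Y : SchemeOver ℂ} (f : Y ⟶ X) (hX : IsSmoothProjective n X)
    (hY : IsSmoothProjective m Y)
    (hHC : ∀ c : complexBetti X (2 * p), IsRationalClass c → IsOfHodgeType n X (2 * p) p p c →
      c ∈ algebraicClasses X p)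
    (hinj : Function.Injective (complexBetti.map f (2 * p)))
    {c : complexBetti Y (2 * p)} (hc : c ∈ algebraicClasses Y p)
    (hcf : c ∈ LinearMap.range (complexBetti.map f (2 * p)).hom) :
    ∃ a ∈ algebraicClasses X p, complexBetti.map f (2 * p) a = c := by
  obtain ⟨A, hAr⟩ := exists_isReal_hodgeModel_holds n X hX
  obtain ⟨B, hBr⟩ := exists_isReal_hodgeModel_holds m Y hY
  have hA := hAr.isHodgeSymmetric
  have hB := hBr.isHodgeSymmetric
  set φ := A.hodgeStructureHom hX hodgePQ_independent_of_hodgeModel_holds hA B hY hB f (2 * p)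
    with hφ
  -- the complexification of `f^*` on `H²ᵖ(–(ℂ); ℚ)` is injective
  have hinjφ : Function.Injective (φ.toLinearMap.baseChange ℂ) := by
    intro x y hxy
    have h := congrArg (ofRatClassBaseChange (ComplexPoints Y) (2 * p)) hxy
    rw [HodgeModel.hodgeStructureHom_toLinearMap, HodgeModel.ofRatClassBaseChange_baseChange_map,
      HodgeModel.ofRatClassBaseChange_baseChange_map] at h
    exact ofRatClassBaseChange_injective _ (2 * p) (hinj h)
  refine exists_mem_algebraicClasses_map_eq_of_lift' f hX hY A hA B hB hHC (fun v hv ↦ ?_) hc hcf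
  exact ⟨v, hom_mem_hodgeClasses_of_injective φ hinjφ (p := (p : ℤ)) (by push_cast; ring) hv, rfl⟩

/-- **Item stmt-HodgeConjecture-2617 (`ThickNecessary`) from the route's support item
`WeakLefschetzInjective` ALONE** (Grothendieck's (∗), hypothesis `hF` of
`ampleAdicLefschetz_thickNecessary_of_weakLefschetzInjective`, is discharged by the item
`AlgebraicClassesHodgeType`): in the setting of `ThickDescent` the weak Lefschetz injectivity
makes `f^*` injective on `H²ᵖ(X(ℂ); ℂ)`, and `exists_mem_algebraicClasses_map_eq_of_injective'`
applies with HC for `X`. [cite: VoisinHodgeII2003, Thm. 1.23] [cite: VoisinHodgeI2002, §7.3.2 and Prop. 11.20] -/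
theorem ampleAdicLefschetz_thickNecessary_of_weakLefschetzInjective'
    (hW : Summit.HodgeConjecture.HodgeConjecture.Theses.AmpleAdicLefschetz.WeakLefschetzInjective) :
    Summit.HodgeConjecture.HodgeConjecture.Theses.AmpleAdicLefschetz.ThickNecessary := by
  unfold Summit.HodgeConjecture.HodgeConjecture.Theses.AmpleAdicLefschetz.ThickNecessary
    Summit.HodgeConjecture.HodgeConjecture.Theses.AmpleAdicLefschetz.ThickDescent
  intro hHC n m p X Y f hX hY hf s hs hcov hle c hc hcf
  exact exists_mem_algebraicClasses_map_eq_of_injective' f hX hY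
    (fun c hc hh ↦ (hHC hX).2 p c hc hh) (hW f hX hf s hs hcov (2 * p) hle) hc hcf

end Summit.HodgeConjecture.HodgeConjecture.Theorems
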